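import Literature.MathematicalPhysics.QuantumManyBody.LiebYngvasonCellMethod
import Literature.MathematicalPhysics.QuantumManyBody.LiebYngvasonLowerBoundAssembly
import Mathlib.MeasureTheory.Measure.Lebesgue.VolumeOfBalls
import HarnessLib

/-!
# The Lieb–Yngvason lower bound: the bound (2.54) in a small Neumann box

Topic `Literature/MathematicalPhysics/QuantumManyBody`, sibling of `LiebYngvasonLowerBound.lean`
(provefact `Literature.MathematicalPhysics.QuantumManyBody.BoseGas.LSSY2005_lowerBound_dirichlet`). This file discharges the named fact
`LSSY2005_boxLowerBound` [LSSY2005, (2.54)–(2.56)] — `E₀(n,ℓ) ≥ (4πa/ℓ³) n(n-1) K(n,ℓ)` for `n`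
bosons in a Neumann box of side `ℓ` — *relative to its two analytic inputs*, which are recorded here
as named facts and proved in sibling files:

* `LSSY2005_dysonBound_boxN` — Dyson's lemma in the box, [LSSY2005, Lemma 2.5 and Cor. 2.6,
  (2.36)–(2.43)]: `H_n ≥ a W_R` as quadratic forms on `C¹(Λ^n)`, `W_R = ∑ᵢ U_R(tᵢ)` the nearest-
  neighbour interaction (2.41)–(2.42) for Dyson's soft potential `U_R` (2.44');
* `neumannPoincare_boxN` — the Neumann gap of the cube, `E₁⁽⁰⁾ = π²/ℓ²` [LSSY2005, after (2.50)]: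
  the sharp Poincaré–Wirtinger inequality `(π²/ℓ²) ∫_{Λ^n} |Ψ - ⟨Ψ⟩|² ≤ ∫_{Λ^n} |∇Ψ|²`.

Proved here:

* `dysonPotential`, `nnDist`, `dysonW` — `U_R`, `tᵢ`, `W_R` of (2.41)–(2.44) and their elementary
  properties, including the pointwise form of (2.50), `W_R² ≤ 3n(R³-R₀³)⁻¹ W_R` (`dysonW_sq_le`);
* the first-order bounds (2.44) in the constant state: `lintegral_dysonW_le` (`⟨W_R⟩₀ ≤
  4πn(n-1)/ℓ³`) and `le_lintegral_dysonW` (the lower bound, with the nearest-neighbour probability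
  in the provable form `(1 - 4πR₀³/3ℓ³)^{n-1} - (1 - 4πR³/3ℓ³)^{n-1}`, see the module docstring of
  `LiebYngvasonLowerBound.lean`, "On the function `K`");
* `temple_bound` — Temple's inequality (2.46)–(2.47) for `H = εT_n + V`, `V ≥ 0` bounded, in the
  constant ground state of `εT_n`, with `E₁` replaced by the unperturbed gap `E₁⁽⁰⁾ = επ²/ℓ²`
  (2.48)–(2.49), in an elementary form that needs only the Poincaré inequality (no spectral
  theorem): writing `Ψ = ⟨Ψ⟩ + Φ`, `t = ‖Φ‖²`, one has `ε∫|∇Ψ|² ≥ E₁⁽⁰⁾ t` and completes a square in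
  `V`;
* `LSSY2005_boxLowerBound_of_parts` — (2.54)–(2.56) from the two inputs, and the end-to-end
  reductions `LSSY2005_lowerBound_neumann_of_inputs`, `LSSY2005_lowerBound_dirichlet_of_inputs`,
  `LSSY2005_lowerBound_periodic_of_inputs` of Theorem 2.4 to the two inputs (through
  `LSSY2005_lowerBound_neumann_of_parts`, `LSSY2005_cellDecomposition_holds`,
  `LSSY2005_superadditivity_holds`).

## References

* [LSSY2005] E. H. Lieb, R. Seiringer, J. P. Solovej, J. Yngvason, *The Mathematics of the Bose Gas
  and its Condensation*, Oberwolfach Seminars 34, Birkhäuser 2005 (arXiv:cond-mat/0610117): Lemma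
  2.5, Cor. 2.6 (2.36)–(2.43) p. 14; (2.44)–(2.51) p. 15; (2.54)–(2.56) p. 16.
* [LiebYngvason1998] E. H. Lieb, J. Yngvason, *Ground state energy of the low density Bose gas*,
  Phys. Rev. Lett. 80 (1998) 2504–2507, eqs. (20)–(21).
-/

noncomputable section

open MeasureTheory Filter Metric
open scoped ENNReal NNReal

namespace Literature.MathematicalPhysics.QuantumManyBody.BoseGas

/-! ### Dyson's soft potential and the nearest-neighbour interaction `W_R` -/

/-- Dyson's soft potential `U_R(r) = 3(R³ - R₀³)⁻¹` for `R₀ < r < R`, `0` otherwise, so that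
`∫ U_R(r) r² dr = 1` and `U_R = 0` for `r ≤ R₀`. [cite: LSSY2005, (2.44) (softU)] -/
def dysonPotential (R₀ R : ℝ) (r : ℝ) : ℝ≥0∞ :=
  Set.indicator (Set.Ioo R₀ R) (fun _ => ENNReal.ofReal (3 / (R ^ 3 - R₀ ^ 3))) r

/-- The distance `tᵢ = min_{j ≠ i} |xᵢ - xⱼ|` of `xᵢ` to its nearest neighbour among the other
points (junk value `0` when there is no other point). [cite: LSSY2005, Cor. 2.6 (2.42')] -/
def nnDist {n : ℕ} (X : Config n) (i : Fin n) : ℝ :=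
  if h : (Finset.univ.erase i).Nonempty then
    (Finset.univ.erase i).inf' h fun j => dist (X i) (X j)
  else 0

/-- The nearest-neighbour interaction `W_R(x₁, …, x_n) = ∑ᵢ U_R(tᵢ)`.
[cite: LSSY2005, Cor. 2.6 (2.41') and (2.44)] -/
def dysonW {n : ℕ} (R₀ R : ℝ) (X : Config n) : ℝ≥0∞ :=
  ∑ i, dysonPotential R₀ R (nnDist X i)

/-! ### The two analytic inputs, as named facts -/

/-- **Dyson's lemma in the box (LSSY Lemma 2.5 / Corollary 2.6, quadratic-form version).**
Let `v ≥ 0` be measurable with `v(r) = 0` for `r > R₀ ≥ 0`, with (finite) scattering length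
`a`, and let `R > R₀`. For every `C¹` function `Ψ` on `Λ_ℓ^n`,
`∫_{Λ^n} (|∇Ψ|² + ∑_{i<j} v(|xᵢ-xⱼ|)|Ψ|²) ≥ a ∫_{Λ^n} W_R |Ψ|²` (`μ = 1`), i.e.
`H_n ≥ μ a W_R` as forms with Neumann conditions: for each `i` and fixed positions of the other
particles, split `Λ` into the Voronoi cells of the other points (convex, hence star-shaped
with respect to their centres) and apply Lemma 2.5 there with `U = U_R`, keeping of the
potential only the nearest-neighbour term `½ v(|xᵢ - x_{j(i)}|)`. Lemma 2.5 in turn is proved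
ray by ray from the variational principle for the scattering length (Thm. C.1).
[cite: LSSY2005, Lemma 2.5 (2.36) and Cor. 2.6 (2.40)–(2.43)] -/
def LSSY2005_dysonBound_boxN : Prop :=
  ∀ (v : ℝ → ℝ≥0∞) (R₀ : ℝ), Measurable v → 0 ≤ R₀ → (∀ r, R₀ < r → v r = 0) →
    scatteringLength v ≠ ⊤ →
  ∀ (n : ℕ) (ℓ R : ℝ), R₀ < R → ∀ (ψ : Config n → ℂ), ContDiff ℝ 1 ψ →
    scatteringLength v * ∫⁻ X in boxN n ℓ, dysonW R₀ R X * (‖ψ X‖₊ : ℝ≥0∞) ^ 2 ≤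
      ∫⁻ X in boxN n ℓ, kineticDensity ψ X + interaction v X * (‖ψ X‖₊ : ℝ≥0∞) ^ 2

/-- **The Neumann gap of the cube (sharp Poincaré–Wirtinger inequality).** For `ℓ > 0` and
every `C¹` function `Ψ` on `Λ_ℓ^n = (0,ℓ)^{3n}`,
`(π²/ℓ²) ∫_{Λ^n} |Ψ - ⟨Ψ⟩|² ≤ ∫_{Λ^n} |∇Ψ|²`, `⟨Ψ⟩` the mean of `Ψ` over `Λ^n`: the second
Neumann eigenvalue of `-Δ` on the cube of side `ℓ` (in any dimension) is `π²/ℓ²`, "the kinetic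
energy of a single particle in the first excited state in the box", `E₁⁽⁰⁾ = επ²μ/ℓ²` for
`εT_n`. (One-dimensional Wirtinger inequality on `(0, ℓ)` for functions without boundary
condition, tensorised.) [cite: LSSY2005, after (2.50)] -/
def neumannPoincare_boxN : Prop :=
  ∀ (n : ℕ) (ℓ : ℝ), 0 < ℓ → ∀ (ψ : Config n → ℂ), ContDiff ℝ 1 ψ →
    ENNReal.ofReal (Real.pi ^ 2 / ℓ ^ 2) *
        ∫⁻ X in boxN n ℓ, (‖ψ X - ⨍ Y in boxN n ℓ, ψ Y‖₊ : ℝ≥0∞) ^ 2 ≤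
      ∫⁻ X in boxN n ℓ, kineticDensity ψ X

/-! ### Elementary properties of `U_R`, `tᵢ`, `W_R` -/

section Basic

variable {n : ℕ} {R₀ R : ℝ}

/-- `U_R(r) = 3(R³-R₀³)⁻¹` on the shell `R₀ < r < R`. [cite: LSSY2005, (2.44) (softU)] -/
theorem dysonPotential_of_mem {r : ℝ} (h : r ∈ Set.Ioo R₀ R) :
    dysonPotential R₀ R r = ENNReal.ofReal (3 / (R ^ 3 - R₀ ^ 3)) :=
  Set.indicator_of_mem h _

/-- `U_R(r) = 0` off the shell `R₀ < r < R`. [cite: LSSY2005, (2.44) (softU)] -/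
theorem dysonPotential_of_not_mem {r : ℝ} (h : r ∉ Set.Ioo R₀ R) : dysonPotential R₀ R r = 0 :=
  Set.indicator_of_notMem h _

/-- `U_R ≤ 3(R³-R₀³)⁻¹` everywhere. [cite: LSSY2005, (2.44) (softU)] -/
theorem dysonPotential_le (r : ℝ) :
    dysonPotential R₀ R r ≤ ENNReal.ofReal (3 / (R ^ 3 - R₀ ^ 3)) :=
  Set.indicator_le_self' (fun _ _ => bot_le) r |>.trans le_rfl

/-- `U_R` is measurable. [folklore] -/
theorem measurable_dysonPotential (R₀ R : ℝ) : Measurable (dysonPotential R₀ R) :=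
  measurable_const.indicator measurableSet_Ioo

/-- `U_R(0) = 0` when `R₀ ≥ 0`. [cite: LSSY2005, Lemma 2.5 (`U(r) = 0` for `r < R₀`)] -/
theorem dysonPotential_zero_of_nonneg (hR₀ : 0 ≤ R₀) : dysonPotential R₀ R 0 = 0 :=
  dysonPotential_of_not_mem fun h => (not_lt.2 hR₀) h.1

/-- `U_R² = 3(R³-R₀³)⁻¹ U_R`. [cite: LSSY2005, after (2.50)] -/
theorem dysonPotential_sq (r : ℝ) :
    dysonPotential R₀ R r ^ 2 = ENNReal.ofReal (3 / (R ^ 3 - R₀ ^ 3)) * dysonPotential R₀ R r := by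
  by_cases h : r ∈ Set.Ioo R₀ R
  · rw [dysonPotential_of_mem h, sq]
  · rw [dysonPotential_of_not_mem h]; simp

/-- The nearest-neighbour distance `tᵢ` is a continuous function of the configuration. [folklore] -/
theorem continuous_nnDist (i : Fin n) : Continuous fun X : Config n => nnDist X i := by
  unfold nnDist
  split_ifs with h
  · exact Continuous.finset_inf'_apply h fun j _ =>
      (continuous_apply i).dist (continuous_apply j)
  · exact continuous_const

/-- `W_R` is measurable. [folklore] -/
theorem measurable_dysonW (R₀ R : ℝ) : Measurable (dysonW (n := n) R₀ R) :=
  Finset.measurable_sum _ fun i _ =>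
    (measurable_dysonPotential R₀ R).comp (continuous_nnDist i).measurable

/-- `W_R ≤ n · 3(R³-R₀³)⁻¹`. [cite: LSSY2005, (2.50)] -/
theorem dysonW_le (X : Config n) :
    dysonW R₀ R X ≤ n * ENNReal.ofReal (3 / (R ^ 3 - R₀ ^ 3)) := by
  unfold dysonW
  calc ∑ i, dysonPotential R₀ R (nnDist X i)
      ≤ ∑ _i : Fin n, ENNReal.ofReal (3 / (R ^ 3 - R₀ ^ 3)) :=
        Finset.sum_le_sum fun i _ => dysonPotential_le _
    _ = n * ENNReal.ofReal (3 / (R ^ 3 - R₀ ^ 3)) := by simp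

/-- **(2.50), pointwise**: `W_R² ≤ 3n(R³-R₀³)⁻¹ W_R`. [cite: LSSY2005, (2.50)] -/
theorem dysonW_sq_le (X : Config n) :
    dysonW R₀ R X ^ 2 ≤ n * ENNReal.ofReal (3 / (R ^ 3 - R₀ ^ 3)) * dysonW R₀ R X := by
  rw [sq]
  exact mul_le_mul_left (dysonW_le X) _

/-- If there is another point, the nearest-neighbour distance is attained.
[cite: LSSY2005, Cor. 2.6 (2.42)] -/
theorem exists_nnDist_eq (X : Config n) (i : Fin n) (h : (Finset.univ.erase i).Nonempty) :
    ∃ j, j ≠ i ∧ nnDist X i = dist (X i) (X j) := by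
  obtain ⟨j, hj, hjeq⟩ := Finset.exists_mem_eq_inf' h fun j => dist (X i) (X j)
  refine ⟨j, (Finset.mem_erase.1 hj).1, ?_⟩
  rw [nnDist, dif_pos h, hjeq]

/-- `tᵢ ≤ |xᵢ - xⱼ|` for every `j ≠ i`. [cite: LSSY2005, Cor. 2.6 (2.42)] -/
theorem nnDist_le_dist (X : Config n) {i j : Fin n} (hij : j ≠ i) :
    nnDist X i ≤ dist (X i) (X j) := by
  have h : (Finset.univ.erase i).Nonempty := ⟨j, Finset.mem_erase.2 ⟨hij, Finset.mem_univ _⟩⟩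
  rw [nnDist, dif_pos h]
  exact Finset.inf'_le _ (Finset.mem_erase.2 ⟨hij, Finset.mem_univ _⟩)

/-- `t < tᵢ` iff all other points are at distance `> t` from `xᵢ`. [cite: LSSY2005, Cor. 2.6 (2.42)]
-/
theorem lt_nnDist_iff (X : Config n) (i : Fin n) (h : (Finset.univ.erase i).Nonempty) (t : ℝ) :
    t < nnDist X i ↔ ∀ j, j ≠ i → t < dist (X i) (X j) := by
  rw [nnDist, dif_pos h, Finset.lt_inf'_iff]
  simp

/-- `U_R(tᵢ) ≤ ∑_{j ≠ i} U_R(|xᵢ - xⱼ|)` (for `R₀ ≥ 0`). [cite: LSSY2005, (2.44)] -/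
theorem dysonPotential_nnDist_le (hR₀ : 0 ≤ R₀) (X : Config n) (i : Fin n) :
    dysonPotential R₀ R (nnDist X i) ≤
      ∑ j ∈ Finset.univ.erase i, dysonPotential R₀ R (dist (X i) (X j)) := by
  by_cases h : (Finset.univ.erase i).Nonempty
  · obtain ⟨j, hj, hjeq⟩ := exists_nnDist_eq X i h
    rw [hjeq]
    exact Finset.single_le_sum (f := fun j => dysonPotential R₀ R (dist (X i) (X j)))
      (fun _ _ => bot_le) (Finset.mem_erase.2 ⟨hj, Finset.mem_univ _⟩)
  · rw [nnDist, dif_neg h, dysonPotential_zero_of_nonneg hR₀]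
    exact bot_le

end Basic

/-! ### The mean of `W_R` in the constant state: the upper bound in (2.44) -/

section Geometry

variable {n : ℕ} {R₀ R : ℝ}

/-- `|(0,ℓ)³| = ℓ³`. [folklore] -/
theorem volume_box (ℓ : ℝ) : volume (box ℓ) = ENNReal.ofReal ℓ ^ 3 := by
  have h : box ℓ = (@WithLp.ofLp 2 (Fin 3 → ℝ)) ⁻¹' (Set.univ.pi fun _ => Set.Ioo 0 ℓ) := by
    ext x; simp [box]
  rw [h, (PiLp.volume_preserving_ofLp (Fin 3)).measure_preimage
    (MeasurableSet.univ_pi fun _ => measurableSet_Ioo).nullMeasurableSet, volume_pi_pi]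
  simp

/-- `|Λ_ℓ^n| = ℓ^{3n}`. [folklore] -/
theorem volume_boxN (n : ℕ) (ℓ : ℝ) : volume (boxN n ℓ) = (ENNReal.ofReal ℓ ^ 3) ^ n := by
  rw [measure_congr (boxN_ae_eq_cellN n ℓ), volume_cellN]

/-- `∫_{ℝ³} U_R(|y|) dy = 3(R³-R₀³)⁻¹ · (4π/3)(R³ - R₀³) = 4π`.
[cite: LSSY2005, Lemma 2.5 (`∫U(r)r²dr ≤ 1`)] -/
theorem lintegral_dysonPotential_norm (hR₀ : 0 ≤ R₀) (hR : R₀ < R) :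
    ∫⁻ y : Space, dysonPotential R₀ R ‖y‖ = ENNReal.ofReal (4 * Real.pi) := by
  have hRpos : 0 < R := hR₀.trans_lt hR
  have hset : ∀ y : Space, dysonPotential R₀ R ‖y‖ =
      (Metric.ball (0 : Space) R \ Metric.closedBall 0 R₀).indicator
        (fun _ => ENNReal.ofReal (3 / (R ^ 3 - R₀ ^ 3))) y := by
    intro y
    by_cases h : ‖y‖ ∈ Set.Ioo R₀ R
    · rw [dysonPotential_of_mem h, Set.indicator_of_mem]
      simpa [and_comm] using h
    · rw [dysonPotential_of_not_mem h, Set.indicator_of_notMem]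
      simpa [and_comm] using h
  have hΔ : 0 < R ^ 3 - R₀ ^ 3 := sub_pos.2 (pow_lt_pow_left₀ hR hR₀ three_ne_zero)
  simp_rw [hset]
  rw [lintegral_indicator_const (measurableSet_ball.diff measurableSet_closedBall),
    measure_sdiff (Metric.closedBall_subset_ball hR) measurableSet_closedBall.nullMeasurableSet
      measure_closedBall_lt_top.ne,
    EuclideanSpace.volume_ball_fin_three, EuclideanSpace.volume_closedBall_fin_three,
    ← ENNReal.ofReal_pow hRpos.le, ← ENNReal.ofReal_pow hR₀,
    ← ENNReal.ofReal_mul (p := R ^ 3) (by positivity),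
    ← ENNReal.ofReal_mul (p := R₀ ^ 3) (by positivity),
    ← ENNReal.ofReal_sub _ (by positivity : (0 : ℝ) ≤ R₀ ^ 3 * (Real.pi * 4 / 3)),
    ← ENNReal.ofReal_mul (p := 3 / (R ^ 3 - R₀ ^ 3)) (div_nonneg (by norm_num) hΔ.le)]
  congr 1
  field_simp

/-- The embedding `Fin 1 ↪ Fin n` picking the particle `i`. [folklore] -/
def singleEmb (i : Fin n) : Fin 1 ↪ Fin n := ⟨fun _ => i, fun a b _ => Subsingleton.elim a b⟩

/-- `singleEmb i` is constantly `i`. [folklore] -/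
@[simp] theorem singleEmb_apply (i : Fin n) (k : Fin 1) : singleEmb i k = i := rfl

/-- The other particles are off the range of `singleEmb i`. [folklore] -/
theorem not_mem_range_singleEmb {i j : Fin n} (hij : j ≠ i) : j ∉ Set.range (singleEmb i) := by
  rintro ⟨k, hk⟩; exact hij hk.symm

/-- There are `n - 1` other particles. [folklore] -/
theorem card_compl_range_singleEmb (i : Fin n) :
    Fintype.card {k // k ∉ Set.range (singleEmb i)} = n - 1 := by
  classical
  rw [Fintype.card_subtype_compl, Fintype.card_fin]
  congr 1

/-- The volume of the constraint "all other particles in the box". [folklore] -/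
theorem volume_setOf_forall_mem_box (i : Fin n) (ℓ : ℝ) :
    volume {Z : {k // k ∉ Set.range (singleEmb i)} → Space | ∀ k, Z k ∈ box ℓ} =
      (ENNReal.ofReal ℓ ^ 3) ^ (n - 1) := by
  have : {Z : {k // k ∉ Set.range (singleEmb i)} → Space | ∀ k, Z k ∈ box ℓ} =
      Set.univ.pi fun _ => box ℓ := by
    ext Z; simp
  rw [this, volume_pi_pi]
  simp [volume_box]

/-- Integrating out one particle over all of `ℝ³`: `∫_{Λ^n} U_R(|xᵢ - xⱼ|) dX ≤ 4π ℓ^{3(n-1)}`.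
[cite: LSSY2005, (2.44)] -/
theorem lintegral_dysonPotential_dist_le (hR₀ : 0 ≤ R₀) (hR : R₀ < R) (ℓ : ℝ) {i j : Fin n}
    (hij : j ≠ i) :
    ∫⁻ X in boxN n ℓ, dysonPotential R₀ R (dist (X i) (X j)) ≤
      ENNReal.ofReal (4 * Real.pi) * (ENNReal.ofReal ℓ ^ 3) ^ (n - 1) := by
  set ι := singleEmb i with hι
  set g := glueEquiv ι 0 with hg_def
  have hg := volume_preserving_glueEquiv ι 0
  have hj : j ∉ Set.range ι := not_mem_range_singleEmb hij
  set B := {Z : {k // k ∉ Set.range ι} → Space | ∀ k, Z k ∈ box ℓ} with hB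
  set f : Config n → ℝ≥0∞ := fun X => dysonPotential R₀ R (dist (X i) (X j)) with hf
  have hfm : Measurable f :=
    (measurable_dysonPotential R₀ R).comp
      ((measurable_config_apply i).dist (measurable_config_apply j))
  have hsub : boxN n ℓ ⊆ g '' (Set.univ ×ˢ B) := by
    intro X hX
    refine ⟨g.symm X, ⟨trivial, fun k => ?_⟩, g.apply_symm_apply X⟩
    simp only [hg_def, glueEquiv_symm_apply]
    exact hX k
  have hinner : ∀ Z : {k // k ∉ Set.range ι} → Space,
      ∫⁻ Y : Config 1, f (g (Y, Z)) = ENNReal.ofReal (4 * Real.pi) := by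
    intro Z
    have h1 : ∀ Y : Config 1, f (g (Y, Z)) = dysonPotential R₀ R (dist (Y 0) (Z ⟨j, hj⟩)) := by
      intro Y
      simp only [hf, hg_def]
      rw [show i = ι 0 from rfl, glueEquiv_apply_ι, glueEquiv_apply_of_not_mem ι 0 Y Z j hj,
        zero_add]
    simp_rw [h1]
    have h2 := ((volume_preserving_funUnique (Fin 1) Space).lintegral_comp_emb
      (MeasurableEquiv.funUnique (Fin 1) Space).measurableEmbedding
      (fun y => dysonPotential R₀ R (dist y (Z ⟨j, hj⟩))))
    calc ∫⁻ Y : Config 1, dysonPotential R₀ R (dist (Y 0) (Z ⟨j, hj⟩))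
        = ∫⁻ y : Space, dysonPotential R₀ R (dist y (Z ⟨j, hj⟩)) := h2
      _ = ∫⁻ y : Space, dysonPotential R₀ R ‖y - Z ⟨j, hj⟩‖ := by simp_rw [dist_eq_norm]
      _ = ∫⁻ y : Space, dysonPotential R₀ R ‖y‖ :=
          lintegral_sub_right_eq_self (μ := (volume : Measure Space))
            (fun y => dysonPotential R₀ R ‖y‖) (Z ⟨j, hj⟩)
      _ = ENNReal.ofReal (4 * Real.pi) := lintegral_dysonPotential_norm hR₀ hR
  calc ∫⁻ X in boxN n ℓ, f X ≤ ∫⁻ X in g '' (Set.univ ×ˢ B), f X := lintegral_mono_set hsub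
    _ = ∫⁻ p in Set.univ ×ˢ B, f (g p) ∂(volume.prod volume) := by
        rw [← Measure.volume_eq_prod]
        exact (hg.setLIntegral_comp_emb g.measurableEmbedding _ _).symm
    _ = ∫⁻ Z in B, ∫⁻ Y, f (g (Y, Z)) := by
        rw [setLIntegral_prod_symm (fun p => f (g p)) (hfm.comp g.measurable).aemeasurable,
          Measure.restrict_univ]
    _ = ∫⁻ _Z in B, ENNReal.ofReal (4 * Real.pi) := lintegral_congr fun Z => hinner Z
    _ = ENNReal.ofReal (4 * Real.pi) * volume B := setLIntegral_const _ _
    _ = ENNReal.ofReal (4 * Real.pi) * (ENNReal.ofReal ℓ ^ 3) ^ (n - 1) := by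
        rw [hB, volume_setOf_forall_mem_box]

/-- **The upper bound in (2.44)**: `∫_{Λ^n} W_R ≤ 4π n(n-1) ℓ^{3(n-1)}`, i.e.
`⟨W_R⟩₀ ≤ 4πn(n-1)/ℓ³` (`≤ 4πρ(1 - 1/n) · n`). [cite: LSSY2005, (2.44)] -/
theorem lintegral_dysonW_le (hR₀ : 0 ≤ R₀) (hR : R₀ < R) (ℓ : ℝ) :
    ∫⁻ X in boxN n ℓ, dysonW R₀ R X ≤
      n * ((n - 1 : ℕ) : ℝ≥0∞) *
        (ENNReal.ofReal (4 * Real.pi) * (ENNReal.ofReal ℓ ^ 3) ^ (n - 1)) := by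
  have hm : ∀ i j : Fin n, Measurable fun X : Config n => dysonPotential R₀ R (dist (X i) (X j)) :=
    fun i j => (measurable_dysonPotential R₀ R).comp
      ((measurable_config_apply i).dist (measurable_config_apply j))
  calc ∫⁻ X in boxN n ℓ, dysonW R₀ R X
      ≤ ∫⁻ X in boxN n ℓ, ∑ i, ∑ j ∈ Finset.univ.erase i,
          dysonPotential R₀ R (dist (X i) (X j)) :=
        lintegral_mono fun X => Finset.sum_le_sum fun i _ => dysonPotential_nnDist_le hR₀ X i
    _ = ∑ i, ∑ j ∈ Finset.univ.erase i,
          ∫⁻ X in boxN n ℓ, dysonPotential R₀ R (dist (X i) (X j)) := by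
        rw [lintegral_finsetSum _ fun i _ => Finset.measurable_sum _ fun j _ => hm i j]
        exact Finset.sum_congr rfl fun i _ => lintegral_finsetSum _ fun j _ => hm i j
    _ ≤ ∑ i : Fin n, ∑ _j ∈ Finset.univ.erase i,
          ENNReal.ofReal (4 * Real.pi) * (ENNReal.ofReal ℓ ^ 3) ^ (n - 1) :=
        Finset.sum_le_sum fun i _ => Finset.sum_le_sum fun j hj =>
          lintegral_dysonPotential_dist_le hR₀ hR ℓ (Finset.mem_erase.1 hj).1
    _ = n * ((n - 1 : ℕ) : ℝ≥0∞) *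
          (ENNReal.ofReal (4 * Real.pi) * (ENNReal.ofReal ℓ ^ 3) ^ (n - 1)) := by
        simp only [Finset.sum_const, Finset.card_erase_of_mem (Finset.mem_univ _),
          Finset.card_univ, Fintype.card_fin, nsmul_eq_mul]
        ring

/-! ### The mean of `W_R` in the constant state: the lower bound in (2.44) -/

/-- The inner box `{x | R < x_k < ℓ - R}`: points at distance `> R` from the boundary of `Λ_ℓ`
(in each coordinate), of volume `(ℓ - 2R)³` — the factor `(1 - 2R/ℓ)³` of (2.44).
[cite: LSSY2005, (2.44)] -/
def innerBox (R ℓ : ℝ) : Set Space :=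
  {x | ∀ k, x k ∈ Set.Ioo R (ℓ - R)}

/-- The inner box is measurable. [folklore] -/
theorem measurableSet_innerBox (R ℓ : ℝ) : MeasurableSet (innerBox R ℓ) := by
  have : innerBox R ℓ = ⋂ k : Fin 3, (fun x : Space => x k) ⁻¹' Set.Ioo R (ℓ - R) := by
    ext x; simp [innerBox]
  rw [this]
  exact MeasurableSet.iInter fun k => measurableSet_Ioo.preimage (by fun_prop)

/-- The inner box has volume `(ℓ - 2R)³`. [cite: LSSY2005, (2.44)] -/
theorem volume_innerBox (R ℓ : ℝ) : volume (innerBox R ℓ) = ENNReal.ofReal (ℓ - 2 * R) ^ 3 := by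
  have h : innerBox R ℓ =
      (@WithLp.ofLp 2 (Fin 3 → ℝ)) ⁻¹' (Set.univ.pi fun _ => Set.Ioo R (ℓ - R)) := by
    ext x; simp [innerBox]
  rw [h, (PiLp.volume_preserving_ofLp (Fin 3)).measure_preimage
    (MeasurableSet.univ_pi fun _ => measurableSet_Ioo).nullMeasurableSet, volume_pi_pi]
  simp only [Real.volume_Ioo, Finset.prod_const, Finset.card_univ, Fintype.card_fin]
  congr 2
  ring

/-- Balls of radius `≤ R` about points of the inner box lie in `Λ_ℓ`. [cite: LSSY2005, (2.44)] -/
theorem ball_subset_box_of_mem_innerBox {R ℓ : ℝ} {x : Space} (hx : x ∈ innerBox R ℓ) {r : ℝ}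
    (hr : r ≤ R) : Metric.ball x r ⊆ box ℓ := by
  intro z hz k
  have hzk : |z k - x k| < R := by
    have h1 : ‖(z - x) k‖ ≤ ‖z - x‖ := PiLp.norm_apply_le (z - x) k
    rw [PiLp.sub_apply, Real.norm_eq_abs] at h1
    exact h1.trans_lt ((mem_ball_iff_norm.1 hz).trans_le hr)
  have h := hx k
  rw [abs_lt] at hzk
  constructor <;> linarith [h.1, h.2]

/-- The inner box lies in the box (for `R > 0`). [folklore] -/
theorem innerBox_subset_box {R ℓ : ℝ} (hR : 0 < R) : innerBox R ℓ ⊆ box ℓ := fun _ hx =>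
  ball_subset_box_of_mem_innerBox hx le_rfl (Metric.mem_ball_self hR)

/-- If the other particles are all in `Λ ∖ B̄(y, R₀)` but not all in `Λ ∖ B(y, R)`, `y = xᵢ`,
then the nearest neighbour of `xᵢ` is in the shell `R₀ < tᵢ < R`, where
`U_R(tᵢ) = 3(R³-R₀³)⁻¹`. [cite: LSSY2005, (2.44)] -/
theorem dysonPotential_nnDist_glueEquiv_eq {R₀ R : ℝ} (i : Fin n) (Y : Config 1)
    (Z : {k // k ∉ Set.range (singleEmb i)} → Space) (ℓ : ℝ)
    (hZ : Z ∈ (Set.univ.pi fun _ => box ℓ \ Metric.closedBall (Y 0) R₀) \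
      (Set.univ.pi fun _ => box ℓ \ Metric.ball (Y 0) R)) :
    dysonPotential R₀ R (nnDist (glueEquiv (singleEmb i) 0 (Y, Z)) i) =
      ENNReal.ofReal (3 / (R ^ 3 - R₀ ^ 3)) := by
  set X := glueEquiv (singleEmb i) 0 (Y, Z) with hX
  have h1 : ∀ k, Z k ∈ box ℓ \ Metric.closedBall (Y 0) R₀ := fun k => Set.mem_univ_pi.1 hZ.1 k
  have h2 : ¬ ∀ k, Z k ∈ box ℓ \ Metric.ball (Y 0) R := fun h => hZ.2 (Set.mem_univ_pi.2 h)
  push Not at h2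
  obtain ⟨k, hk⟩ := h2
  have hkball : Z k ∈ Metric.ball (Y 0) R := by
    by_contra hb
    exact hk ⟨(h1 k).1, hb⟩
  have hki : (k : Fin n) ≠ i := fun h => k.2 ⟨0, h.symm⟩
  have hne : (Finset.univ.erase i).Nonempty :=
    ⟨k, Finset.mem_erase.2 ⟨hki, Finset.mem_univ _⟩⟩
  have hXi : X i = Y 0 := (glueEquiv_apply_ι (singleEmb i) 0 Y Z 0).trans (zero_add _)
  have hXj : ∀ (j : Fin n) (hj : j ∉ Set.range (singleEmb i)), X j = Z ⟨j, hj⟩ :=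
    fun j hj => glueEquiv_apply_of_not_mem _ 0 Y Z j hj
  apply dysonPotential_of_mem
  constructor
  · rw [lt_nnDist_iff X i hne]
    intro j hj
    have hj' : j ∉ Set.range (singleEmb i) := not_mem_range_singleEmb hj
    rw [hXi, hXj j hj', dist_comm]
    exact not_le.1 (h1 ⟨j, hj'⟩).2
  · refine (nnDist_le_dist X hki).trans_lt ?_
    rw [hXi, hXj k k.2, dist_comm]
    exact Metric.mem_ball.1 hkball

/-- The volume of "the other particles all in `Λ ∖ B̄(y,R₀)` but not all in `Λ ∖ B(y,R)`" is
`(ℓ³ - (4π/3)R₀³)^{n-1} - (ℓ³ - (4π/3)R³)^{n-1}`, for `y` in the inner box.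
[cite: LSSY2005, (2.44)] -/
theorem volume_shellEvent {R₀ R ℓ : ℝ} (hR₀ : 0 ≤ R₀) (hR : R₀ < R) (i : Fin n) {y : Space}
    (hy : y ∈ innerBox R ℓ) :
    volume ((Set.univ.pi fun _ : {k // k ∉ Set.range (singleEmb i)} =>
        box ℓ \ Metric.closedBall y R₀) \
      (Set.univ.pi fun _ : {k // k ∉ Set.range (singleEmb i)} => box ℓ \ Metric.ball y R)) =
      ENNReal.ofReal (ℓ ^ 3 - R₀ ^ 3 * (Real.pi * 4 / 3)) ^ (n - 1) -
        ENNReal.ofReal (ℓ ^ 3 - R ^ 3 * (Real.pi * 4 / 3)) ^ (n - 1) := by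
  have hRpos : 0 < R := hR₀.trans_lt hR
  have hballbox : Metric.ball y R ⊆ box ℓ := ball_subset_box_of_mem_innerBox hy le_rfl
  have hcballbox : Metric.closedBall y R₀ ⊆ box ℓ :=
    (Metric.closedBall_subset_ball hR).trans hballbox
  have hℓ : 0 ≤ ℓ := by
    have := hy 0
    linarith [this.1, this.2, hRpos]
  have hv1 : volume (box ℓ \ Metric.closedBall y R₀) =
      ENNReal.ofReal (ℓ ^ 3 - R₀ ^ 3 * (Real.pi * 4 / 3)) := by
    rw [measure_sdiff hcballbox measurableSet_closedBall.nullMeasurableSet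
      measure_closedBall_lt_top.ne, volume_box, EuclideanSpace.volume_closedBall_fin_three,
      ← ENNReal.ofReal_pow hℓ, ← ENNReal.ofReal_pow hR₀,
      ← ENNReal.ofReal_mul (p := R₀ ^ 3) (by positivity), ← ENNReal.ofReal_sub _ (by positivity)]
  have hv2 : volume (box ℓ \ Metric.ball y R) =
      ENNReal.ofReal (ℓ ^ 3 - R ^ 3 * (Real.pi * 4 / 3)) := by
    rw [measure_sdiff hballbox measurableSet_ball.nullMeasurableSet measure_ball_lt_top.ne,
      volume_box, EuclideanSpace.volume_ball_fin_three, ← ENNReal.ofReal_pow hℓ,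
      ← ENNReal.ofReal_pow hRpos.le, ← ENNReal.ofReal_mul (p := R ^ 3) (by positivity),
      ← ENNReal.ofReal_sub _ (by positivity)]
  have hsub : (Set.univ.pi fun _ : {k // k ∉ Set.range (singleEmb i)} => box ℓ \ Metric.ball y R) ⊆
      Set.univ.pi fun _ => box ℓ \ Metric.closedBall y R₀ :=
    Set.pi_mono fun _ _ => Set.sdiff_subset_sdiff_right (Metric.closedBall_subset_ball hR)
  have hfin : volume (Set.univ.pi fun _ : {k // k ∉ Set.range (singleEmb i)} =>
      box ℓ \ Metric.ball y R) ≠ ⊤ := by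
    rw [volume_pi_pi]
    exact ENNReal.prod_ne_top fun _ _ =>
      ((measure_mono Set.sdiff_subset).trans_lt (volume_box ℓ ▸ ENNReal.pow_lt_top
        ENNReal.ofReal_lt_top)).ne
  rw [measure_sdiff hsub (MeasurableSet.univ_pi fun _ =>
      (measurableSet_box ℓ).diff measurableSet_ball).nullMeasurableSet hfin,
    volume_pi_pi, volume_pi_pi]
  simp only [hv1, hv2, Finset.prod_const, Finset.card_univ, card_compl_range_singleEmb]

/-- **The lower bound in (2.44), per particle**: `∫_{Λ^n} U_R(tᵢ) dX ≥
3(R³-R₀³)⁻¹ · [(ℓ³ - (4π/3)R₀³)^{n-1} - (ℓ³ - (4π/3)R³)^{n-1}] · (ℓ - 2R)³` — restrict `xᵢ` to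
the inner box (so that the balls `B(xᵢ, R) ⊆ Λ`) and count the configurations of the others
whose nearest point to `xᵢ` is in the shell. [cite: LSSY2005, (2.44)] -/
theorem le_lintegral_dysonPotential_nnDist {R₀ R ℓ : ℝ} (hR₀ : 0 ≤ R₀) (hR : R₀ < R)
    (i : Fin n) :
    ENNReal.ofReal (3 / (R ^ 3 - R₀ ^ 3)) *
        (ENNReal.ofReal (ℓ ^ 3 - R₀ ^ 3 * (Real.pi * 4 / 3)) ^ (n - 1) -
          ENNReal.ofReal (ℓ ^ 3 - R ^ 3 * (Real.pi * 4 / 3)) ^ (n - 1)) *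
        ENNReal.ofReal (ℓ - 2 * R) ^ 3 ≤
      ∫⁻ X in boxN n ℓ, dysonPotential R₀ R (nnDist X i) := by
  have hRpos : 0 < R := hR₀.trans_lt hR
  set ι := singleEmb i with hι
  set g := glueEquiv ι 0 with hg_def
  have hg := volume_preserving_glueEquiv ι 0
  set B := {Z : {k // k ∉ Set.range ι} → Space | ∀ k, Z k ∈ box ℓ} with hB
  set F : Config n → ℝ≥0∞ := fun X => dysonPotential R₀ R (nnDist X i) with hF
  have hFm : Measurable F := (measurable_dysonPotential R₀ R).comp (continuous_nnDist i).measurable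
  have hpre : g ⁻¹' boxN n ℓ = boxN 1 ℓ ×ˢ B := by
    ext ⟨Y, Z⟩
    simp only [Set.mem_preimage, boxN, Set.mem_setOf_eq, Set.mem_prod, hB]
    constructor
    · intro h
      refine ⟨fun k => ?_, fun k => ?_⟩
      · have := h i
        rw [Subsingleton.elim k 0]
        rwa [hg_def, show i = ι 0 from rfl, glueEquiv_apply_ι, zero_add] at this
      · have := h k
        rwa [hg_def, glueEquiv_apply_of_not_mem ι 0 Y Z k k.2] at this
    · rintro ⟨hY, hZ⟩ k
      by_cases hk : k ∈ Set.range ι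
      · obtain ⟨k₀, rfl⟩ := hk
        rw [hg_def, glueEquiv_apply_ι, zero_add, Subsingleton.elim k₀ 0]
        exact hY 0
      · rw [hg_def, glueEquiv_apply_of_not_mem ι 0 Y Z k hk]
        exact hZ ⟨k, hk⟩
  -- the inner box for particle `i`
  set I₁ : Set (Config 1) := Set.univ.pi fun _ => innerBox R ℓ with hI₁
  have hI₁sub : I₁ ⊆ boxN 1 ℓ := fun Y hY k => innerBox_subset_box hRpos (Set.mem_univ_pi.1 hY k)
  have hI₁meas : MeasurableSet I₁ := MeasurableSet.univ_pi fun _ => measurableSet_innerBox R ℓ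
  have hI₁vol : volume I₁ = ENNReal.ofReal (ℓ - 2 * R) ^ 3 := by
    rw [hI₁, volume_pi_pi]
    simp [volume_innerBox]
  -- the shell event for the others
  set S : Config 1 → Set ({k // k ∉ Set.range ι} → Space) := fun Y =>
    (Set.univ.pi fun _ => box ℓ \ Metric.closedBall (Y 0) R₀) \
      (Set.univ.pi fun _ => box ℓ \ Metric.ball (Y 0) R) with hS
  have hSsub : ∀ Y, S Y ⊆ B := fun Y Z hZ k => (Set.mem_univ_pi.1 hZ.1 k).1
  have hSmeas : ∀ Y, MeasurableSet (S Y) := fun Y =>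
    (MeasurableSet.univ_pi fun _ => (measurableSet_box ℓ).diff measurableSet_closedBall).diff
      (MeasurableSet.univ_pi fun _ => (measurableSet_box ℓ).diff measurableSet_ball)
  set c := ENNReal.ofReal (3 / (R ^ 3 - R₀ ^ 3)) *
    (ENNReal.ofReal (ℓ ^ 3 - R₀ ^ 3 * (Real.pi * 4 / 3)) ^ (n - 1) -
      ENNReal.ofReal (ℓ ^ 3 - R ^ 3 * (Real.pi * 4 / 3)) ^ (n - 1)) with hc
  have hinner : ∀ Y ∈ I₁, c ≤ ∫⁻ Z in B, F (g (Y, Z)) := by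
    intro Y hY
    calc c = ENNReal.ofReal (3 / (R ^ 3 - R₀ ^ 3)) * volume (S Y) := by
          rw [hc, hS, volume_shellEvent hR₀ hR i (Set.mem_univ_pi.1 hY 0)]
      _ = ∫⁻ _Z in S Y, ENNReal.ofReal (3 / (R ^ 3 - R₀ ^ 3)) := (setLIntegral_const _ _).symm
      _ = ∫⁻ Z in S Y, F (g (Y, Z)) := by
          refine setLIntegral_congr_fun (hSmeas Y) fun Z hZ => ?_
          exact (dysonPotential_nnDist_glueEquiv_eq i Y Z ℓ hZ).symm
      _ ≤ ∫⁻ Z in B, F (g (Y, Z)) := lintegral_mono_set (hSsub Y)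
  calc c * ENNReal.ofReal (ℓ - 2 * R) ^ 3 = ∫⁻ _Y in I₁, c := by
        rw [setLIntegral_const, hI₁vol]
    _ ≤ ∫⁻ Y in I₁, ∫⁻ Z in B, F (g (Y, Z)) := setLIntegral_mono' hI₁meas fun Y hY => hinner Y hY
    _ ≤ ∫⁻ Y in boxN 1 ℓ, ∫⁻ Z in B, F (g (Y, Z)) := lintegral_mono_set hI₁sub
    _ = ∫⁻ p in boxN 1 ℓ ×ˢ B, F (g p) ∂(volume.prod volume) :=
        (setLIntegral_prod (fun p => F (g p)) (hFm.comp g.measurable).aemeasurable).symm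
    _ = ∫⁻ X in boxN n ℓ, F X := by
        rw [← hpre, ← Measure.volume_eq_prod]
        exact hg.setLIntegral_comp_preimage_emb g.measurableEmbedding F _

/-- **The lower bound in (2.44)**: `∫_{Λ^n} W_R ≥
n · 3(R³-R₀³)⁻¹ [(ℓ³ - (4π/3)R₀³)^{n-1} - (ℓ³ - (4π/3)R³)^{n-1}] (ℓ - 2R)³`.
[cite: LSSY2005, (2.44)] -/
theorem le_lintegral_dysonW {R₀ R ℓ : ℝ} (hR₀ : 0 ≤ R₀) (hR : R₀ < R) :
    n * (ENNReal.ofReal (3 / (R ^ 3 - R₀ ^ 3)) *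
        (ENNReal.ofReal (ℓ ^ 3 - R₀ ^ 3 * (Real.pi * 4 / 3)) ^ (n - 1) -
          ENNReal.ofReal (ℓ ^ 3 - R ^ 3 * (Real.pi * 4 / 3)) ^ (n - 1)) *
        ENNReal.ofReal (ℓ - 2 * R) ^ 3) ≤
      ∫⁻ X in boxN n ℓ, dysonW R₀ R X := by
  unfold dysonW
  rw [lintegral_finsetSum Finset.univ (f := fun i X => dysonPotential R₀ R (nnDist X i))
    fun i _ => (measurable_dysonPotential R₀ R).comp (continuous_nnDist i).measurable]
  calc _ = ∑ _i : Fin n, ENNReal.ofReal (3 / (R ^ 3 - R₀ ^ 3)) *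
        (ENNReal.ofReal (ℓ ^ 3 - R₀ ^ 3 * (Real.pi * 4 / 3)) ^ (n - 1) -
          ENNReal.ofReal (ℓ ^ 3 - R ^ 3 * (Real.pi * 4 / 3)) ^ (n - 1)) *
        ENNReal.ofReal (ℓ - 2 * R) ^ 3 := by simp
    _ ≤ _ := Finset.sum_le_sum fun i _ => le_lintegral_dysonPotential_nnDist hR₀ hR i

end Geometry

/-! ### Temple's inequality for `εT + V'` in the constant state (elementary form) -/

section Temple

variable {n : ℕ} {ℓ : ℝ}

/-- Bounded measurable functions are integrable on the box. [folklore] -/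
theorem integrableOn_boxN_of_bound {E : Type*} [NormedAddCommGroup E] {f : Config n → E}
    (hf : AEStronglyMeasurable f (volume.restrict (boxN n ℓ))) (C : ℝ)
    (hC : ∀ X ∈ boxN n ℓ, ‖f X‖ ≤ C) : IntegrableOn f (boxN n ℓ) := by
  refine IntegrableOn.of_bound (volume_boxN_lt_top n ℓ) hf C ?_
  exact (ae_restrict_iff' (measurableSet_boxN n ℓ)).2 (Filter.Eventually.of_forall hC)

/-- A continuous function is bounded on the box. [folklore] -/
theorem exists_bound_on_boxN {E : Type*} [NormedAddCommGroup E] {f : Config n → E}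
    (hf : Continuous f) (ℓ : ℝ) : ∃ C, ∀ X ∈ boxN n ℓ, ‖f X‖ ≤ C := by
  obtain ⟨C, hC⟩ := (isCompact_closedBall (0 : Config n) (3 * |ℓ|)).exists_bound_of_continuousOn
    hf.continuousOn
  exact ⟨C, fun X hX => hC X (boxN_subset_closedBall n ℓ hX)⟩

/-- `ENNReal.ofReal ‖z‖² = ‖z‖₊²`. [folklore] -/
theorem ofReal_norm_sq_eq (z : ℂ) : ENNReal.ofReal (‖z‖ ^ 2) = (‖z‖₊ : ℝ≥0∞) ^ 2 := by
  rw [ENNReal.ofReal_pow (norm_nonneg _), ← enorm_eq_nnnorm, ← ofReal_norm]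

/-- **Temple's inequality, elementary version, for `h = εT + V` on `Λ_ℓ^n` with Neumann
conditions.** Let `Ψ` be a normalised `C¹` function on `Λ^n`, `V ≥ 0` bounded measurable,
`ε > 0`, and write `⟨·⟩₀` for the average over `Λ^n` (the ground state of `εT_n` is the
constant, of energy `0`; its gap is `E₁⁽⁰⁾ = επ²/ℓ²` by the Neumann Poincaré inequality). If
`E₁⁽⁰⁾ > ⟨V⟩₀` then
`ε ∫|∇Ψ|² + ∫ V|Ψ|² ≥ ⟨V⟩₀ - ⟨V²⟩₀ / (E₁⁽⁰⁾ - ⟨V⟩₀)`,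
which is (2.47) with `E₁` replaced by `E₁⁽⁰⁾` and `⟨h⟩₀²` dropped, as used in (2.49). Proof:
write `Ψ = c + Φ` with `c = ⟨Ψ⟩₀`, `∫Φ = 0`, `t = ∫|Φ|²`, `|c|²|Λ^n| = 1 - t`; then
`ε∫|∇Ψ|² ≥ E₁⁽⁰⁾ t` and, pointwise, `V|Ψ|² ≥ |c|²V - κ|c|²V² - |Φ|²/κ` for `κ = (E₁⁽⁰⁾ - ⟨V⟩₀)⁻¹`.
[cite: LSSY2005, (2.46)–(2.49)] -/
theorem temple_bound (hP : neumannPoincare_boxN) (hℓ : 0 < ℓ) (Ψ : NeumannTrialState n ℓ)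
    {V : Config n → ℝ} (hVm : Measurable V) (hV0 : ∀ X, 0 ≤ V X) {Vmax : ℝ}
    (hVb : ∀ X, V X ≤ Vmax) {ε : ℝ} (hε : 0 < ε)
    (hkin : ∫⁻ X in boxN n ℓ, kineticDensity Ψ.ψ X ≠ ⊤)
    (hgap : (∫ X in boxN n ℓ, V X) / (volume (boxN n ℓ)).toReal < ε * Real.pi ^ 2 / ℓ ^ 2) :
    (∫ X in boxN n ℓ, V X) / (volume (boxN n ℓ)).toReal -
        (∫ X in boxN n ℓ, V X ^ 2) / (volume (boxN n ℓ)).toReal /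
          (ε * Real.pi ^ 2 / ℓ ^ 2 - (∫ X in boxN n ℓ, V X) / (volume (boxN n ℓ)).toReal) ≤
      ε * (∫⁻ X in boxN n ℓ, kineticDensity Ψ.ψ X).toReal +
        ∫ X in boxN n ℓ, V X * ‖Ψ.ψ X‖ ^ 2 := by
  -- notation
  set L := (volume (boxN n ℓ)).toReal with hL_def
  set M1 := ∫ X in boxN n ℓ, V X with hM1
  set M2 := ∫ X in boxN n ℓ, V X ^ 2 with hM2
  set g := ε * Real.pi ^ 2 / ℓ ^ 2 with hg_def
  set ψ := Ψ.ψ with hψ_def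
  have hψc : Continuous ψ := Ψ.contDiff.continuous
  have hLpos : 0 < L := by
    rw [hL_def, volume_boxN]
    simp only [ENNReal.toReal_pow, ENNReal.toReal_ofReal hℓ.le]
    positivity
  have hLne : L ≠ 0 := hLpos.ne'
  haveI : IsFiniteMeasure (volume.restrict (boxN n ℓ)) :=
    ⟨by rw [Measure.restrict_apply_univ]; exact volume_boxN_lt_top n ℓ⟩
  -- bounds and integrability
  obtain ⟨Cψ, hCψ⟩ := exists_bound_on_boxN hψc ℓ
  have hVmax0 : 0 ≤ Vmax := (hV0 0).trans (hVb 0)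
  have hψi : IntegrableOn ψ (boxN n ℓ) :=
    integrableOn_boxN_of_bound hψc.aestronglyMeasurable Cψ hCψ
  set c : ℂ := ⨍ X in boxN n ℓ, ψ X with hc_def
  set Φ : Config n → ℂ := fun X => ψ X - c with hΦ_def
  have hΦc : Continuous Φ := hψc.sub continuous_const
  have hΦi : IntegrableOn Φ (boxN n ℓ) := hψi.sub (integrableOn_const (volume_boxN_lt_top n ℓ).ne)
  obtain ⟨CΦ, hCΦ⟩ := exists_bound_on_boxN hΦc ℓ
  have hΦ2i : IntegrableOn (fun X => ‖Φ X‖ ^ 2) (boxN n ℓ) :=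
    integrableOn_boxN_of_bound (hΦc.norm.pow 2).aestronglyMeasurable (CΦ ^ 2) fun X hX => by
      rw [Real.norm_of_nonneg (by positivity)]
      exact pow_le_pow_left₀ (norm_nonneg _) (hCΦ X hX) 2
  have hψ2i : IntegrableOn (fun X => ‖ψ X‖ ^ 2) (boxN n ℓ) :=
    integrableOn_boxN_of_bound (hψc.norm.pow 2).aestronglyMeasurable (Cψ ^ 2) fun X hX => by
      rw [Real.norm_of_nonneg (by positivity)]
      exact pow_le_pow_left₀ (norm_nonneg _) (hCψ X hX) 2
  have hVi : IntegrableOn V (boxN n ℓ) :=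
    integrableOn_boxN_of_bound hVm.aestronglyMeasurable Vmax fun X _ => by
      rw [Real.norm_of_nonneg (hV0 X)]; exact hVb X
  have hV2i : IntegrableOn (fun X => V X ^ 2) (boxN n ℓ) :=
    integrableOn_boxN_of_bound (hVm.pow_const 2).aestronglyMeasurable (Vmax ^ 2) fun X _ => by
      rw [Real.norm_of_nonneg (by positivity)]
      exact pow_le_pow_left₀ (hV0 X) (hVb X) 2
  have hVψi : IntegrableOn (fun X => V X * ‖ψ X‖ ^ 2) (boxN n ℓ) :=
    integrableOn_boxN_of_bound (hVm.mul (hψc.norm.pow 2).measurable).aestronglyMeasurable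
      (Vmax * Cψ ^ 2) fun X hX => by
      rw [Real.norm_of_nonneg (mul_nonneg (hV0 X) (by positivity))]
      exact mul_le_mul (hVb X) (pow_le_pow_left₀ (norm_nonneg _) (hCψ X hX) 2)
        (by positivity) hVmax0
  -- `∫ Φ = 0`
  have hΦint : ∫ X in boxN n ℓ, Φ X = 0 := by
    simp only [hΦ_def]
    rw [integral_sub hψi (integrableOn_const (volume_boxN_lt_top n ℓ).ne), setIntegral_const,
      hc_def, setAverage_eq, smul_smul, measureReal_def, ← hL_def, mul_inv_cancel₀ hLne,
      one_smul, sub_self]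
  -- normalisation `∫ |ψ|² = 1`
  have hnorm : ∫ X in boxN n ℓ, ‖ψ X‖ ^ 2 = 1 := by
    have h := Ψ.norm_eq
    have h2 : ENNReal.ofReal (∫ X in boxN n ℓ, ‖ψ X‖ ^ 2) = 1 := by
      rw [ofReal_integral_eq_lintegral_ofReal hψ2i (Filter.Eventually.of_forall fun X => by
        positivity)]
      simp_rw [ofReal_norm_sq_eq]
      exact h
    have := congrArg ENNReal.toReal h2
    rwa [ENNReal.toReal_ofReal (integral_nonneg fun X => by positivity), ENNReal.toReal_one]
      at this
  -- Pythagoras `1 = |c|² L + t`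
  set t := ∫ X in boxN n ℓ, ‖Φ X‖ ^ 2 with ht_def
  have ht0 : 0 ≤ t := integral_nonneg fun X => by positivity
  have hexpand : ∀ X, ‖ψ X‖ ^ 2 = ‖c‖ ^ 2 + ‖Φ X‖ ^ 2 + 2 * (c * (starRingEnd ℂ) (Φ X)).re := by
    intro X
    have : ψ X = c + Φ X := by simp [hΦ_def]
    rw [this, ← Complex.normSq_eq_norm_sq, ← Complex.normSq_eq_norm_sq,
      ← Complex.normSq_eq_norm_sq, Complex.normSq_add]
  have hcross : ∫ X in boxN n ℓ, (c * (starRingEnd ℂ) (Φ X)).re = 0 := by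
    have hi : Integrable (fun X => c * (starRingEnd ℂ) (Φ X)) (volume.restrict (boxN n ℓ)) :=
      integrableOn_boxN_of_bound
        (continuous_const.mul (Complex.continuous_conj.comp hΦc)).aestronglyMeasurable
        (‖c‖ * CΦ) fun X hX => by
          rw [norm_mul, Complex.norm_conj]
          exact mul_le_mul_of_nonneg_left (hCΦ X hX) (norm_nonneg _)
    have h1 := integral_re hi
    simp only [RCLike.re_to_complex] at h1
    rw [h1, integral_const_mul, integral_conj]
    change (c * (starRingEnd ℂ) (∫ X in boxN n ℓ, Φ X)).re = 0
    rw [hΦint, map_zero, mul_zero, Complex.zero_re]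
  have hcrossi : IntegrableOn (fun X => (c * (starRingEnd ℂ) (Φ X)).re) (boxN n ℓ) :=
    integrableOn_boxN_of_bound
      (Complex.continuous_re.comp (continuous_const.mul
        (Complex.continuous_conj.comp hΦc))).aestronglyMeasurable (‖c‖ * CΦ) fun X hX => by
        rw [Real.norm_eq_abs]
        refine (Complex.abs_re_le_norm _).trans ?_
        rw [norm_mul, Complex.norm_conj]
        exact mul_le_mul_of_nonneg_left (hCΦ X hX) (norm_nonneg _)
  have hpyth : ‖c‖ ^ 2 * L + t = 1 := by
    have hci : IntegrableOn (fun _ : Config n => ‖c‖ ^ 2) (boxN n ℓ) :=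
      integrableOn_const (volume_boxN_lt_top n ℓ).ne
    have hA : IntegrableOn (fun X => ‖c‖ ^ 2 + ‖Φ X‖ ^ 2) (boxN n ℓ) := hci.add hΦ2i
    have hB : IntegrableOn (fun X => 2 * (c * (starRingEnd ℂ) (Φ X)).re) (boxN n ℓ) :=
      hcrossi.const_mul 2
    rw [← hnorm, setIntegral_congr_fun (measurableSet_boxN n ℓ) (fun X _ => hexpand X),
      integral_add hA hB, integral_add hci hΦ2i, setIntegral_const,
      integral_const_mul, hcross, measureReal_def, ← hL_def, ← ht_def]
    simp only [smul_eq_mul, mul_zero, add_zero]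
    ring
  -- the kinetic energy: Poincaré
  set K := ∫⁻ X in boxN n ℓ, kineticDensity ψ X with hK_def
  have hk : Real.pi ^ 2 / ℓ ^ 2 * t ≤ K.toReal := by
    have h := hP n ℓ hℓ ψ Ψ.contDiff
    have hlin : ∫⁻ X in boxN n ℓ, (‖ψ X - ⨍ Y in boxN n ℓ, ψ Y‖₊ : ℝ≥0∞) ^ 2 =
        ENNReal.ofReal t := by
      rw [ht_def, ofReal_integral_eq_lintegral_ofReal hΦ2i
        (Filter.Eventually.of_forall fun X => by positivity)]
      simp_rw [ofReal_norm_sq_eq]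
      rfl
    rw [hlin, ← ENNReal.ofReal_mul (by positivity)] at h
    exact (ENNReal.ofReal_le_iff_le_toReal hkin).1 h
  -- the potential energy, pointwise
  set m := M1 / L with hm_def
  set d := g - m with hd_def
  have hd : 0 < d := by rw [hd_def]; linarith
  set κ := 1 / d with hκ_def
  have hκ : 0 < κ := by positivity
  have hpt : ∀ X, ‖c‖ ^ 2 * V X - κ * ‖c‖ ^ 2 * V X ^ 2 - ‖Φ X‖ ^ 2 / κ ≤ V X * ‖ψ X‖ ^ 2 := by
    intro X
    rw [hexpand X]
    have hr : -(‖c‖ * ‖Φ X‖) ≤ (c * (starRingEnd ℂ) (Φ X)).re := by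
      have h1 := Complex.abs_re_le_norm (c * (starRingEnd ℂ) (Φ X))
      rw [norm_mul, Complex.norm_conj] at h1
      exact (abs_le.1 h1).1
    have hamgm : 2 * ‖c‖ * V X * ‖Φ X‖ ≤ κ * ‖c‖ ^ 2 * V X ^ 2 + ‖Φ X‖ ^ 2 / κ := by
      have : 0 ≤ (κ * ‖c‖ * V X - ‖Φ X‖) ^ 2 / κ := by positivity
      have h' : (κ * ‖c‖ * V X - ‖Φ X‖) ^ 2 / κ =
          κ * ‖c‖ ^ 2 * V X ^ 2 - 2 * ‖c‖ * V X * ‖Φ X‖ + ‖Φ X‖ ^ 2 / κ := by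
        field_simp
        ring
      linarith
    have hV := hV0 X
    nlinarith [mul_le_mul_of_nonneg_left hr (mul_nonneg zero_le_two hV),
      mul_nonneg hV (sq_nonneg ‖Φ X‖), norm_nonneg c]
  set P := ∫ X in boxN n ℓ, V X * ‖ψ X‖ ^ 2 with hP_def
  have hPge : ‖c‖ ^ 2 * M1 - κ * ‖c‖ ^ 2 * M2 - t / κ ≤ P := by
    have hlhs : IntegrableOn (fun X => ‖c‖ ^ 2 * V X - κ * ‖c‖ ^ 2 * V X ^ 2 - ‖Φ X‖ ^ 2 / κ)
        (boxN n ℓ) :=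
      ((hVi.const_mul _).sub (hV2i.const_mul _)).sub (hΦ2i.div_const _)
    calc ‖c‖ ^ 2 * M1 - κ * ‖c‖ ^ 2 * M2 - t / κ
        = ∫ X in boxN n ℓ, ‖c‖ ^ 2 * V X - κ * ‖c‖ ^ 2 * V X ^ 2 - ‖Φ X‖ ^ 2 / κ := by
          have h1 : IntegrableOn (fun X => ‖c‖ ^ 2 * V X) (boxN n ℓ) := hVi.const_mul _
          have h2 : IntegrableOn (fun X => κ * ‖c‖ ^ 2 * V X ^ 2) (boxN n ℓ) :=
            hV2i.const_mul _
          have h3 : IntegrableOn (fun X => ‖Φ X‖ ^ 2 / κ) (boxN n ℓ) := hΦ2i.div_const _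
          have h12 : IntegrableOn (fun X => ‖c‖ ^ 2 * V X - κ * ‖c‖ ^ 2 * V X ^ 2) (boxN n ℓ) :=
            h1.sub h2
          rw [integral_sub h12 h3, integral_sub h1 h2, integral_const_mul,
            integral_const_mul, integral_div, ← hM1, ← hM2, ← ht_def]
      _ ≤ P := setIntegral_mono_on hlhs hVψi (measurableSet_boxN n ℓ) fun X _ => hpt X
  -- assemble
  have hM2nn : 0 ≤ M2 := integral_nonneg fun X => by positivity
  have hc2 : ‖c‖ ^ 2 = (1 - t) / L := by
    field_simp
    linarith
  have hkey : m - M2 / L / d ≤ g * t + (‖c‖ ^ 2 * M1 - κ * ‖c‖ ^ 2 * M2 - t / κ) := by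
    rw [hc2, hκ_def]
    have : g * t + ((1 - t) / L * M1 - 1 / d * ((1 - t) / L) * M2 - t / (1 / d)) -
        (m - M2 / L / d) = t * (M2 / L) / d := by
      rw [hm_def, hd_def] at *
      field_simp
      ring
    have hnn : 0 ≤ t * (M2 / L) / d := by positivity
    linarith
  have hgt : g * t ≤ ε * K.toReal := by
    rw [hg_def]
    have := mul_le_mul_of_nonneg_left hk hε.le
    calc ε * Real.pi ^ 2 / ℓ ^ 2 * t = ε * (Real.pi ^ 2 / ℓ ^ 2 * t) := by ring
      _ ≤ ε * K.toReal := this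
  change m - M2 / L / d ≤ ε * K.toReal + P
  linarith

end Temple

/-! ### Assembly of (2.54) from Dyson's lemma and Temple's inequality -/

section BoxAssembly

variable {n : ℕ}

/-- Mean-value bound `m (y - x) (1 - y)^m ≤ (1 - x)^m - (1 - y)^m` for `x ≤ y ≤ 1`
(the nearest-neighbour probability against the printed first-order factor, cf. the module
docstring of `LiebYngvasonLowerBound`). [folklore] -/
theorem mul_sub_mul_pow_le_pow_sub_pow {x y : ℝ} (hxy : x ≤ y) (hy0 : 0 ≤ y) (hy : y ≤ 1)
    (m : ℕ) : (m : ℝ) * (y - x) * (1 - y) ^ m ≤ (1 - x) ^ m - (1 - y) ^ m := by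
  induction m with
  | zero => simp
  | succ m ih =>
    have h1 : 0 ≤ 1 - y := sub_nonneg.2 hy
    have h2 : 1 - y ≤ 1 - x := by linarith
    have h3 : 0 ≤ (1 - y) ^ m := pow_nonneg h1 m
    have h5 : (1 - y) ^ (m + 1) ≤ (1 - y) ^ m :=
      pow_le_pow_of_le_one h1 (by linarith) (Nat.le_succ m)
    have hc : 0 ≤ (m : ℝ) * (y - x) * (1 - y) ^ m :=
      mul_nonneg (mul_nonneg (Nat.cast_nonneg m) (sub_nonneg.2 hxy)) h3
    calc ((m + 1 : ℕ) : ℝ) * (y - x) * (1 - y) ^ (m + 1)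
        = (1 - y) * ((m : ℝ) * (y - x) * (1 - y) ^ m) + (y - x) * (1 - y) ^ (m + 1) := by
          push_cast; ring
      _ ≤ (1 - x) * ((1 - x) ^ m - (1 - y) ^ m) + (y - x) * (1 - y) ^ m := by
          gcongr ?_ + ?_
          · exact mul_le_mul h2 ih hc (by linarith)
          · exact mul_le_mul_of_nonneg_left h5 (sub_nonneg.2 hxy)
      _ = (1 - x) ^ (m + 1) - (1 - y) ^ (m + 1) := by ring

/-- The mean of a bounded `ℝ≥0∞`-valued function over the box, as a real (Bochner) integral.
[folklore] -/
theorem integral_toReal_boxN {ℓ : ℝ} {F : Config n → ℝ≥0∞} (hF : Measurable F) {C : ℝ≥0∞}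
    (hC : C ≠ ⊤) (hFC : ∀ X, F X ≤ C) :
    ∫ X in boxN n ℓ, (F X).toReal = (∫⁻ X in boxN n ℓ, F X).toReal :=
  integral_toReal hF.aemeasurable (Filter.Eventually.of_forall fun X =>
    (hFC X).trans_lt hC.lt_top)

set_option maxHeartbeats 1600000 in
/-- **(2.54) from its parts.** Dyson's lemma in the box (Cor. 2.6, (2.43)) and the Neumann gap
`E₁⁰ = π²/ℓ²` (through the elementary Temple inequality `temple_bound`, (2.45)–(2.49)),
together with the nearest-neighbour bounds (2.44) (`lintegral_dysonW_le`, `le_lintegral_dysonW`)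
and (2.50) (`dysonW_sq_le`), give the box bound `LSSY2005_boxLowerBound` (2.54)–(2.56).
[cite: LSSY2005, (2.43)–(2.51) and (2.54)–(2.56)] -/
theorem LSSY2005_boxLowerBound_of_parts (hDy : LSSY2005_dysonBound_boxN)
    (hP : neumannPoincare_boxN) : LSSY2005_boxLowerBound := by
  intro v R₀ hv hR₀ hrange hafin n ℓ ε R hε hε1 hR h2R a hden
  have ha_def : a = (scatteringLength v).toReal := rfl
  clear_value a
  have hRpos : 0 < R := hR₀.trans_lt hR
  have hℓ : 0 < ℓ := by linarith
  have ha0 : 0 ≤ a := by rw [ha_def]; exact ENNReal.toReal_nonneg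
  have hπ := Real.pi_pos
  have hπ4 := Real.pi_le_four
  have hΔ : 0 < R ^ 3 - R₀ ^ 3 := sub_pos.2 (pow_lt_pow_left₀ hR hR₀ three_ne_zero)
  set D := Real.pi * ε / ℓ ^ 2 - 4 * a * n * (n - 1) / ℓ ^ 3 with hD_def
  set τ := 3 * a * n / (Real.pi * (R ^ 3 - R₀ ^ 3) * D) with hτ_def
  set y := 4 * Real.pi * R ^ 3 / (3 * ℓ ^ 3) with hy_def
  set x := 4 * Real.pi * R₀ ^ 3 / (3 * ℓ ^ 3) with hx_def
  have hK : lyK a R₀ R ε ℓ n = (1 - ε) * (1 - 2 * R / ℓ) ^ 3 * (1 - y) ^ (n - 1) * (1 - τ) := by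
    simp only [lyK, hy_def, hτ_def, hD_def]
  -- `0 ≤ x ≤ y ≤ 1`
  have hx0 : 0 ≤ x := by rw [hx_def]; positivity
  have hxy : x ≤ y := by
    rw [hx_def, hy_def]
    gcongr
  have hy1 : y ≤ 1 := by
    rw [hy_def, div_le_one (by positivity)]
    have h8 : R ^ 3 ≤ ℓ ^ 3 / 8 := by
      have : R ≤ ℓ / 2 := by linarith
      calc R ^ 3 ≤ (ℓ / 2) ^ 3 := pow_le_pow_left₀ hRpos.le this 3
        _ = ℓ ^ 3 / 8 := by ring
    nlinarith [pow_pos hℓ 3]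
  have h2Rℓ : 0 < 1 - 2 * R / ℓ := by
    rw [sub_pos, div_lt_one hℓ]; exact h2R
  have hτ0 : 0 ≤ τ := by rw [hτ_def]; positivity
  -- trivial cases: `n ≤ 1`, or `K ≤ 0`
  rcases lt_or_ge n 2 with hn2 | hn2
  · have : (n : ℝ) * (n - 1) = 0 := by
      interval_cases n <;> simp
    rw [show 4 * Real.pi * a / ℓ ^ 3 * n * (n - 1) * lyK a R₀ R ε ℓ n =
      4 * Real.pi * a / ℓ ^ 3 * (n * (n - 1)) * lyK a R₀ R ε ℓ n by ring, this]
    simp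
  rcases le_or_gt (1 - τ) 0 with hτ1 | hτ1
  · have hK0 : lyK a R₀ R ε ℓ n ≤ 0 := by
      rw [hK]
      exact mul_nonpos_of_nonneg_of_nonpos (by positivity) hτ1
    have : 4 * Real.pi * a / ℓ ^ 3 * n * (n - 1) * lyK a R₀ R ε ℓ n ≤ 0 := by
      have hnn : (0 : ℝ) ≤ 4 * Real.pi * a / ℓ ^ 3 * n * (n - 1) := by
        have : (1 : ℝ) ≤ n := by exact_mod_cast (by omega : 1 ≤ n)
        have : (0 : ℝ) ≤ n - 1 := by linarith
        positivity
      exact mul_nonpos_of_nonneg_of_nonpos hnn hK0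
    rw [ENNReal.ofReal_of_nonpos this]
    exact bot_le
  -- main case: `n ≥ 2`, `τ < 1`
  have hn1 : (1 : ℝ) ≤ n := by exact_mod_cast (by omega : 1 ≤ n)
  have hncast : ((n - 1 : ℕ) : ℝ) = n - 1 := by
    rw [Nat.cast_sub (by omega : 1 ≤ n), Nat.cast_one]
  have hnn1 : (0 : ℝ) ≤ n * (n - 1) := mul_nonneg (by positivity) (by linarith)
  refine le_iInf fun Ψ => ?_
  set ψ := Ψ.ψ with hψ_def
  set E := neumannEnergy v Ψ with hE_def
  rcases eq_or_ne E ⊤ with hEtop | hEtop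
  · rw [hEtop]; exact le_top
  -- the pieces of the energy
  set T := ∫⁻ X in boxN n ℓ, kineticDensity ψ X with hT_def
  set I := ∫⁻ X in boxN n ℓ, interaction v X * (‖ψ X‖₊ : ℝ≥0∞) ^ 2 with hI_def
  have hETI : E = T + I := by
    rw [hE_def, neumannEnergy, hT_def, hI_def]
    exact lintegral_add_left (measurable_kineticDensity Ψ.contDiff) _
  have hT : T ≠ ⊤ := fun h => hEtop (by rw [hETI, h, top_add])
  have hI : I ≠ ⊤ := fun h => hEtop (by rw [hETI, h, add_top])
  -- Dyson (2.43)
  set WΨ := ∫⁻ X in boxN n ℓ, dysonW R₀ R X * (‖ψ X‖₊ : ℝ≥0∞) ^ 2 with hWΨ_def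
  have hDyson : scatteringLength v * WΨ ≤ E := by
    rw [hE_def, neumannEnergy]
    exact hDy v R₀ hv hR₀ hrange hafin n ℓ R hR ψ Ψ.contDiff
  set Cw := (n : ℝ≥0∞) * ENNReal.ofReal (3 / (R ^ 3 - R₀ ^ 3)) with hCw_def
  have hCw : Cw ≠ ⊤ := ENNReal.mul_ne_top (ENNReal.natCast_ne_top n) ENNReal.ofReal_ne_top
  have hWle : ∀ X : Config n, dysonW R₀ R X ≤ Cw := fun X => dysonW_le X
  have hWΨ : WΨ ≠ ⊤ := by
    refine ne_top_of_le_ne_top (ENNReal.mul_ne_top hCw ENNReal.one_ne_top) ?_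
    calc WΨ ≤ ∫⁻ X in boxN n ℓ, Cw * (‖ψ X‖₊ : ℝ≥0∞) ^ 2 :=
          lintegral_mono fun X => mul_le_mul_left (hWle X) _
      _ = Cw * 1 := by
          rw [lintegral_const_mul' _ _ hCw, Ψ.norm_eq]
  -- the mean of `W_R`
  set Wbar := ∫⁻ X in boxN n ℓ, dysonW R₀ R X with hWbar_def
  have hvol : volume (boxN n ℓ) = ENNReal.ofReal (ℓ ^ (3 * n)) := by
    rw [volume_boxN, ← ENNReal.ofReal_pow hℓ.le, ← ENNReal.ofReal_pow (by positivity), ← pow_mul]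
  have hL : (volume (boxN n ℓ)).toReal = ℓ ^ (3 * n) := by
    rw [hvol, ENNReal.toReal_ofReal (by positivity)]
  have hWbar : Wbar ≠ ⊤ := by
    refine ne_top_of_le_ne_top (ENNReal.mul_ne_top hCw (hvol ▸ ENNReal.ofReal_ne_top)) ?_
    calc Wbar ≤ ∫⁻ _X in boxN n ℓ, Cw := lintegral_mono fun X => hWle X
      _ = Cw * volume (boxN n ℓ) := setLIntegral_const _ _
  -- (2.44), upper bound, in reals
  have hWup : Wbar.toReal ≤ n * (n - 1) * (4 * Real.pi * (ℓ ^ 3) ^ (n - 1)) := by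
    have h := lintegral_dysonW_le (n := n) hR₀ hR ℓ
    have hne : (n : ℝ≥0∞) * ((n - 1 : ℕ) : ℝ≥0∞) *
        (ENNReal.ofReal (4 * Real.pi) * (ENNReal.ofReal ℓ ^ 3) ^ (n - 1)) ≠ ⊤ :=
      ENNReal.mul_ne_top (ENNReal.mul_ne_top (ENNReal.natCast_ne_top _) (ENNReal.natCast_ne_top _))
        (ENNReal.mul_ne_top ENNReal.ofReal_ne_top
          (ENNReal.pow_ne_top (ENNReal.pow_ne_top ENNReal.ofReal_ne_top)))
    have := ENNReal.toReal_mono hne h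
    rw [ENNReal.toReal_mul, ENNReal.toReal_mul, ENNReal.toReal_mul, ENNReal.toReal_natCast,
      ENNReal.toReal_natCast, ENNReal.toReal_ofReal (by positivity), ENNReal.toReal_pow,
      ENNReal.toReal_pow, ENNReal.toReal_ofReal hℓ.le, hncast] at this
    exact this
  -- (2.44), lower bound, in reals
  set A := ℓ ^ 3 - R₀ ^ 3 * (Real.pi * 4 / 3) with hA_def
  set B := ℓ ^ 3 - R ^ 3 * (Real.pi * 4 / 3) with hB_def
  have hAx : A = ℓ ^ 3 * (1 - x) := by
    rw [hA_def, hx_def]; field_simp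
  have hBy : B = ℓ ^ 3 * (1 - y) := by
    rw [hB_def, hy_def]; field_simp
  have hB0 : 0 ≤ B := by rw [hBy]; exact mul_nonneg (by positivity) (sub_nonneg.2 hy1)
  have hBA : B ≤ A := by rw [hAx, hBy]; gcongr
  have hA0 : 0 ≤ A := hB0.trans hBA
  have hABpow : B ^ (n - 1) ≤ A ^ (n - 1) := pow_le_pow_left₀ hB0 hBA _
  set low := (n : ℝ) * (3 / (R ^ 3 - R₀ ^ 3) * (A ^ (n - 1) - B ^ (n - 1)) * (ℓ - 2 * R) ^ 3)
    with hlow_def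
  have hlowE : ENNReal.ofReal low = n * (ENNReal.ofReal (3 / (R ^ 3 - R₀ ^ 3)) *
      (ENNReal.ofReal A ^ (n - 1) - ENNReal.ofReal B ^ (n - 1)) *
        ENNReal.ofReal (ℓ - 2 * R) ^ 3) := by
    rw [hlow_def, ENNReal.ofReal_mul (Nat.cast_nonneg n), ENNReal.ofReal_natCast,
      ENNReal.ofReal_mul (mul_nonneg (div_nonneg (by norm_num) hΔ.le) (sub_nonneg.2 hABpow)),
      ENNReal.ofReal_mul (div_nonneg (by norm_num) hΔ.le), ENNReal.ofReal_sub _ (pow_nonneg hB0 _),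
      ENNReal.ofReal_pow hA0, ENNReal.ofReal_pow hB0, ENNReal.ofReal_pow (by linarith)]
  have hWlow : low ≤ Wbar.toReal := by
    have h := le_lintegral_dysonW (n := n) (ℓ := ℓ) hR₀ hR
    rw [← hA_def, ← hB_def, ← hlowE] at h
    exact (ENNReal.ofReal_le_iff_le_toReal hWbar).1 h
  -- Temple's inequality for `εT + (1-ε) a W_R`
  set b := (1 - ε) * a with hb_def
  have hb0 : 0 ≤ b := mul_nonneg (by linarith) ha0
  have hba : b ≤ a := by rw [hb_def]; nlinarith
  set V : Config n → ℝ := fun X => b * (dysonW R₀ R X).toReal with hV_def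
  have hVm : Measurable V := (measurable_dysonW R₀ R).ennreal_toReal.const_mul b
  have hV0 : ∀ X, 0 ≤ V X := fun X => mul_nonneg hb0 ENNReal.toReal_nonneg
  have hWreal : ∀ X : Config n, (dysonW R₀ R X).toReal ≤ n * (3 / (R ^ 3 - R₀ ^ 3)) := by
    intro X
    have := ENNReal.toReal_mono hCw (hWle X)
    rwa [hCw_def, ENNReal.toReal_mul, ENNReal.toReal_natCast,
      ENNReal.toReal_ofReal (div_nonneg (by norm_num) hΔ.le)] at this
  have hVb : ∀ X, V X ≤ b * (n * (3 / (R ^ 3 - R₀ ^ 3))) := fun X =>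
    mul_le_mul_of_nonneg_left (hWreal X) hb0
  have hIV : ∫ X in boxN n ℓ, V X = b * Wbar.toReal := by
    simp only [hV_def]
    rw [integral_const_mul, integral_toReal_boxN (measurable_dysonW R₀ R) hCw hWle]
  have hIV2 : ∫ X in boxN n ℓ, V X ^ 2 ≤ b * (n * (3 / (R ^ 3 - R₀ ^ 3))) * (b * Wbar.toReal) := by
    have hpt : ∀ X, V X ^ 2 ≤ b * (n * (3 / (R ^ 3 - R₀ ^ 3))) * V X := by
      intro X
      rw [sq]
      exact mul_le_mul_of_nonneg_right (hVb X) (hV0 X)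
    calc ∫ X in boxN n ℓ, V X ^ 2 ≤ ∫ X in boxN n ℓ, b * (n * (3 / (R ^ 3 - R₀ ^ 3))) * V X := by
          refine integral_mono_of_nonneg (Filter.Eventually.of_forall fun X => sq_nonneg _) ?_
            (Filter.Eventually.of_forall hpt)
          exact (integrableOn_boxN_of_bound hVm.aestronglyMeasurable _ fun X _ => by
            rw [Real.norm_of_nonneg (hV0 X)]; exact hVb X).const_mul _
      _ = b * (n * (3 / (R ^ 3 - R₀ ^ 3))) * (b * Wbar.toReal) := by
          rw [integral_const_mul, hIV]
  have hIVψ : ∫ X in boxN n ℓ, V X * ‖ψ X‖ ^ 2 = b * WΨ.toReal := by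
    have h1 : ∀ X, V X * ‖ψ X‖ ^ 2 =
        b * (dysonW R₀ R X * (‖ψ X‖₊ : ℝ≥0∞) ^ 2).toReal := by
      intro X
      rw [hV_def, ENNReal.toReal_mul, ENNReal.toReal_pow, ENNReal.coe_toReal, coe_nnnorm, mul_assoc]
    simp_rw [h1]
    rw [integral_const_mul]
    congr 1
    obtain ⟨Cψ, hCψ⟩ := exists_bound_on_boxN Ψ.contDiff.continuous ℓ
    refine integral_toReal ((measurable_dysonW R₀ R).mul
      (measurable_normSq Ψ.contDiff.continuous)).aemeasurable ?_
    exact Filter.Eventually.of_forall fun X => ENNReal.mul_lt_top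
      ((hWle X).trans_lt hCw.lt_top) (ENNReal.pow_lt_top ENNReal.coe_lt_top)
  -- the gap condition
  set g := ε * Real.pi ^ 2 / ℓ ^ 2 with hg_def
  set m := (∫ X in boxN n ℓ, V X) / (volume (boxN n ℓ)).toReal with hm_def
  have hm : m = b * Wbar.toReal / ℓ ^ (3 * n) := by rw [hm_def, hIV, hL]
  have hm0 : 0 ≤ m := by rw [hm]; positivity
  have hℓ3n : ℓ ^ (3 * n) = ℓ ^ 3 * (ℓ ^ 3) ^ (n - 1) := by
    rw [← pow_mul, ← pow_add]
    congr 1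
    omega
  have hm_up : m ≤ b * (4 * Real.pi * n * (n - 1) / ℓ ^ 3) := by
    rw [hm, hℓ3n]
    have hℓ3 : 0 < ℓ ^ 3 := pow_pos hℓ 3
    have hℓ3n' : 0 < (ℓ ^ 3) ^ (n - 1) := pow_pos hℓ3 _
    rw [div_le_iff₀ (mul_pos hℓ3 hℓ3n')]
    calc b * Wbar.toReal ≤ b * (n * (n - 1) * (4 * Real.pi * (ℓ ^ 3) ^ (n - 1))) :=
          mul_le_mul_of_nonneg_left hWup hb0
      _ = b * (4 * Real.pi * n * (n - 1) / ℓ ^ 3) * (ℓ ^ 3 * (ℓ ^ 3) ^ (n - 1)) := by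
          field_simp
  have hgm : Real.pi * D ≤ g - m := by
    have : b * (4 * Real.pi * n * (n - 1) / ℓ ^ 3) ≤ a * (4 * Real.pi * n * (n - 1) / ℓ ^ 3) :=
      mul_le_mul_of_nonneg_right hba (by positivity)
    have hDexp : Real.pi * D = g - a * (4 * Real.pi * n * (n - 1) / ℓ ^ 3) := by
      rw [hD_def, hg_def]; ring
    rw [hDexp]
    linarith
  have hDpos : 0 < Real.pi * D := mul_pos hπ hden
  have hgap : m < g := by linarith
  have hkin : T ≠ ⊤ := hT
  have hTemple := temple_bound hP hℓ Ψ hVm hV0 hVb hε hkin hgap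
  rw [← hm_def, hIVψ] at hTemple
  -- `E ≥ εT + (1-ε) a W_R ≥ Temple`
  have hEreal : ε * T.toReal + b * WΨ.toReal ≤ E.toReal := by
    have h1 : a * WΨ.toReal ≤ T.toReal + I.toReal := by
      have := ENNReal.toReal_mono hEtop hDyson
      rwa [ENNReal.toReal_mul, ← ha_def, hETI, ENNReal.toReal_add hT hI] at this
    rw [hETI, ENNReal.toReal_add hT hI, hb_def]
    have hI0 : 0 ≤ I.toReal := ENNReal.toReal_nonneg
    have hT0 : 0 ≤ T.toReal := ENNReal.toReal_nonneg
    have h2 := mul_le_mul_of_nonneg_left h1 (sub_nonneg.2 hε1.le)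
    have h3 : 0 ≤ ε * I.toReal := mul_nonneg hε.le hI0
    nlinarith [h2, h3]
  -- Temple's error term: `⟨V²⟩/(g - m) ≤ τ m`
  have hM2 : (∫ X in boxN n ℓ, V X ^ 2) / (volume (boxN n ℓ)).toReal ≤
      b * (n * (3 / (R ^ 3 - R₀ ^ 3))) * m := by
    rw [hm_def, hL, ← mul_div_assoc]
    exact div_le_div_of_nonneg_right (hIV2.trans_eq (by rw [hIV])) (by positivity)
  have herr : (∫ X in boxN n ℓ, V X ^ 2) / (volume (boxN n ℓ)).toReal / (g - m) ≤ τ * m := by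
    calc (∫ X in boxN n ℓ, V X ^ 2) / (volume (boxN n ℓ)).toReal / (g - m)
        ≤ b * (n * (3 / (R ^ 3 - R₀ ^ 3))) * m / (Real.pi * D) := by
          refine div_le_div₀ (by positivity) hM2 hDpos hgm
      _ ≤ a * (n * (3 / (R ^ 3 - R₀ ^ 3))) * m / (Real.pi * D) := by
          gcongr
      _ = τ * m := by
          rw [hτ_def]
          field_simp
  have hmain : m * (1 - τ) ≤ E.toReal := by
    have := hTemple.trans hEreal
    nlinarith
  -- the lower bound on `m` and the final algebra
  have hm_low : b * low / ℓ ^ (3 * n) ≤ m := by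
    rw [hm]
    exact div_le_div_of_nonneg_right (mul_le_mul_of_nonneg_left hWlow hb0) (by positivity)
  have hfinal : 4 * Real.pi * a / ℓ ^ 3 * n * (n - 1) * lyK a R₀ R ε ℓ n ≤
      b * low / ℓ ^ (3 * n) * (1 - τ) := by
    rw [hK, hlow_def, hℓ3n, hb_def]
    have hmv := mul_sub_mul_pow_le_pow_sub_pow hxy (hx0.trans hxy) hy1 (n - 1)
    rw [hncast] at hmv
    -- `A^(n-1) - B^(n-1) = (ℓ³)^(n-1) ((1-x)^(n-1) - (1-y)^(n-1))`
    have hAB : A ^ (n - 1) - B ^ (n - 1) =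
        (ℓ ^ 3) ^ (n - 1) * ((1 - x) ^ (n - 1) - (1 - y) ^ (n - 1)) := by
      rw [hAx, hBy, mul_pow, mul_pow]; ring
    have hyx : y - x = 4 * Real.pi * (R ^ 3 - R₀ ^ 3) / (3 * ℓ ^ 3) := by
      rw [hy_def, hx_def]; field_simp
    rw [hAB]
    have hℓ3 : 0 < ℓ ^ 3 := pow_pos hℓ 3
    have hℓ3n' : 0 < (ℓ ^ 3) ^ (n - 1) := pow_pos hℓ3 _
    -- reduce to the mean-value bound
    have key : 4 * Real.pi * a / ℓ ^ 3 * n * (n - 1) *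
        ((1 - ε) * (1 - 2 * R / ℓ) ^ 3 * (1 - y) ^ (n - 1) * (1 - τ)) =
        (1 - ε) * a * (n * (3 / (R ^ 3 - R₀ ^ 3) * ((ℓ ^ 3) ^ (n - 1) *
          ((n - 1) * (y - x) * (1 - y) ^ (n - 1))) * (ℓ - 2 * R) ^ 3)) /
          (ℓ ^ 3 * (ℓ ^ 3) ^ (n - 1)) * (1 - τ) := by
      rw [hyx]
      field_simp
    rw [key]
    have hpos : 0 ≤ (1 - ε) * a * (n * (3 / (R ^ 3 - R₀ ^ 3))) * (ℓ - 2 * R) ^ 3 /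
        (ℓ ^ 3 * (ℓ ^ 3) ^ (n - 1)) * (1 - τ) * (ℓ ^ 3) ^ (n - 1) := by
      have : 0 ≤ ℓ - 2 * R := by linarith
      have : 0 ≤ 1 - ε := by linarith
      positivity
    have := mul_le_mul_of_nonneg_left hmv hpos
    calc _ = (1 - ε) * a * (n * (3 / (R ^ 3 - R₀ ^ 3))) * (ℓ - 2 * R) ^ 3 /
          (ℓ ^ 3 * (ℓ ^ 3) ^ (n - 1)) * (1 - τ) * (ℓ ^ 3) ^ (n - 1) *
          ((n - 1) * (y - x) * (1 - y) ^ (n - 1)) := by ring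
      _ ≤ (1 - ε) * a * (n * (3 / (R ^ 3 - R₀ ^ 3))) * (ℓ - 2 * R) ^ 3 /
          (ℓ ^ 3 * (ℓ ^ 3) ^ (n - 1)) * (1 - τ) * (ℓ ^ 3) ^ (n - 1) *
          ((1 - x) ^ (n - 1) - (1 - y) ^ (n - 1)) := this
      _ = _ := by ring
  -- conclusion
  calc ENNReal.ofReal (4 * Real.pi * a / ℓ ^ 3 * n * (n - 1) * lyK a R₀ R ε ℓ n)
      ≤ ENNReal.ofReal E.toReal := by
        refine ENNReal.ofReal_le_ofReal (hfinal.trans (le_trans ?_ hmain))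
        exact mul_le_mul_of_nonneg_right hm_low hτ1.le
    _ = E := ENNReal.ofReal_toReal hEtop

end BoxAssembly

/-! ### Theorem 2.4 from the two analytic inputs -/

/-- **LSSY Theorem 2.4 (Neumann, as printed) from Dyson's lemma and the Neumann gap**: the box
bound (2.54) (`LSSY2005_boxLowerBound_of_parts`), the cell method (2.52)
(`LSSY2005_cellDecomposition_holds`), superadditivity (2.53) (`LSSY2005_superadditivity_holds`)
and the assembly (2.55)–(2.64) (`LSSY2005_lowerBound_neumann_of_parts`).
[cite: LSSY2005, Thm. 2.4 (2.35)] -/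
theorem LSSY2005_lowerBound_neumann_of_inputs (hDy : LSSY2005_dysonBound_boxN)
    (hP : neumannPoincare_boxN) : LSSY2005_lowerBound_neumann :=
  LSSY2005_lowerBound_neumann_of_parts (LSSY2005_boxLowerBound_of_parts hDy hP)
    LSSY2005_cellDecomposition_holds LSSY2005_superadditivity_holds

/-- The Dirichlet form of Theorem 2.4 (`LSSY2005_lowerBound_dirichlet` of `PeriodicBoseGas.lean`)
from Dyson's lemma and the Neumann gap. [cite: LSSY2005, Thm. 2.4 (2.35)] -/
theorem LSSY2005_lowerBound_dirichlet_of_inputs (hDy : LSSY2005_dysonBound_boxN)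
    (hP : neumannPoincare_boxN) : LSSY2005_lowerBound_dirichlet :=
  LSSY2005_lowerBound_dirichlet_of_neumann (LSSY2005_lowerBound_neumann_of_inputs hDy hP)

/-- The periodic form of Theorem 2.4 (`LSSY2005_lowerBound_periodic` of `PeriodicBoseGas.lean`)
from Dyson's lemma and the Neumann gap. [cite: LSSY2005, Thm. 2.4 (2.35)] -/
theorem LSSY2005_lowerBound_periodic_of_inputs (hDy : LSSY2005_dysonBound_boxN)
    (hP : neumannPoincare_boxN) : LSSY2005_lowerBound_periodic :=
  LSSY2005_lowerBound_periodic_of_neumann (LSSY2005_lowerBound_neumann_of_inputs hDy hP)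

end Literature.MathematicalPhysics.QuantumManyBody.BoseGas

end
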